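import Summits.Ventures.PercRepro.S2SeriesCapSeven

/-!
# PercRepro — S2: THE SERIES-CLASS AVERAGING AT NULLITY `7` ON `n` POINTS (p7, gen 8; generic, for S1 / S3)

S2SeriesCapSeven's argument with the point count a parameter: on a coloop-free `e`-free core of nullity `7` on `n ≥ 15` points,
with `s₄ ≤ 28` on every core of nullity `5` (p8's `avgChain16 5`),
* either some point `e` has `≥ 3` series partners — then `e` lies on `≤ 1` quad and `M ∖ e` has `≥ 10` non-coloops, so
  `s₄ ≤ 1 + ⌊28·(n − 4)/(n − 8)⌋ ≤ 46` (`k = 3`, `n − 4 ≥ 11` non-coloops) or `s₄ ≤ ⌊28·10/6⌋ = 46` (`k ≥ 4`);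
* or every point has `≤ 2` partners — then the averaged `x` has `≥ n − 3` non-coloops and
  `s₄ − ⌊4·s₄/n⌋ ≤ ⌊28·(n − 3)/(n − 7)⌋`.
**`ncard_fourCircuits_le_of_seven_free_of_card`**: `s₄ ≤ 46 ∨ s₄ − 4·s₄/n ≤ 28·(n − 3)/(n − 7)`; the user instantiates `n` and
`omega` reads off the bound (`n = 24`: `46`; `n = 23`: `46`; `n = 18`: `48`; `n = 15`: `51`) against the plain chain's
`⌊46·n/(n − 4)⌋` (`55 / 55 / 59 / 62`). Axioms: standard.
-/

open scoped Matroid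

namespace PercRepro

namespace S2

open Set

variable {α : Type}

/-- **The series-class averaging at nullity `7` on `n ≥ 15` points**: `s₄ ≤ 46`, or `s₄ − ⌊4·s₄/n⌋ ≤ ⌊28·(n − 3)/(n − 7)⌋`. -/
theorem ncard_fourCircuits_le_of_seven_free_of_card (M : Matroid α) [M.Finite]
    (hfree : ∀ e ∈ M.E, ∃ A ⊆ M.E \ {e}, e ∉ M.closure A ∧ e ∉ M.closure ((M.E \ {e}) \ A))
    (hd : M.E.encard = M.eRank + 7) {n : ℕ} (hn : M.E.ncard = n) (hn15 : 15 ≤ n) (hcol : M.coloops = ∅)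
    (hB5 : ∀ (M' : Matroid α) [M'.Finite],
      (∀ e ∈ M'.E, ∃ A ⊆ M'.E \ {e}, e ∉ M'.closure A ∧ e ∉ M'.closure ((M'.E \ {e}) \ A)) →
      M'.E.encard = M'.eRank + 5 → {C : Set α | M'.IsCircuit C ∧ C.ncard = 4}.ncard ≤ 28) :
    {C : Set α | M.IsCircuit C ∧ C.ncard = 4}.ncard ≤ 46 ∨
      {C : Set α | M.IsCircuit C ∧ C.ncard = 4}.ncard -
        4 * {C : Set α | M.IsCircuit C ∧ C.ncard = 4}.ncard / n ≤ (n - 3) * 28 / (n - 7) := by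
  classical
  -- the deletion of any point `e`: a core of nullity `6` on `n − 1` points with `k` coloops and `n − 1 − k ≥ 10`
  -- non-coloops; the averaging step with any `m ≤ n − 1 − k` non-coloops
  have hdel : ∀ e ∈ M.E, ∀ k, (M ＼ {e}).coloops.ncard = k → 10 ≤ n - 1 - k ∧ ∀ m, 0 < m → m ≤ n - 1 - k →
      {C : Set α | (M ＼ {e}).IsCircuit C ∧ C.ncard = 4}.ncard -
        4 * {C : Set α | (M ＼ {e}).IsCircuit C ∧ C.ncard = 4}.ncard / m ≤ 28 := by
    intro e heE k hk
    have hec : ¬ M.IsColoop e := by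
      rw [Matroid.isColoop_iff_mem_coloops, hcol]
      exact Set.notMem_empty e
    have hd' : M.E.encard = M.eRank + ((6 : ℕ) + 1) := by rw [hd]; norm_num
    have hfreeN := S1.hfree_delete M hfree e
    have hd6 : (M ＼ {e}).E.encard = (M ＼ {e}).eRank + 6 := delete_nullity_of_nonColoop' M hd' heE hec
    have hNE : (M ＼ {e}).E.ncard = n - 1 := by
      rw [Matroid.delete_ground, Set.ncard_sdiff_singleton_of_mem heE, hn]
    have hKsub : (M ＼ {e}).coloops ⊆ (M ＼ {e}).E := (M ＼ {e}).coloops_subset_ground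
    have hnc : ((M ＼ {e}).E \ (M ＼ {e}).coloops).ncard = n - 1 - k := by
      rw [Set.ncard_sdiff hKsub ((M ＼ {e}).ground_finite.subset hKsub), hNE, hk]
    have h10 := S1.card_nonColoops_ge_ten (M ＼ {e}) hfreeN hd6
    rw [hnc] at h10
    refine ⟨h10, ?_⟩
    intro m hm0 hm
    have hd5 : (M ＼ {e}).E.encard = (M ＼ {e}).eRank + ((5 : ℕ) + 1) := by rw [hd6]; norm_num
    exact S1.ncard_fourCircuits_sub_div_le_of_nonColoops (M ＼ {e}) hfreeN hd5 (m := m) hm0 (by rw [hnc]; exact hm) hB5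
  by_cases hA : ∃ e ∈ M.E, 3 ≤ (M ＼ {e}).coloops.ncard
  · -- CASE A: a point with `≥ 3` series partners — `s₄ ≤ 46`
    left
    obtain ⟨e, heE, hk3⟩ := hA
    obtain ⟨k, hk⟩ : ∃ k, (M ＼ {e}).coloops.ncard = k := ⟨_, rfl⟩
    rw [hk] at hk3
    obtain ⟨h10, havg⟩ := hdel e heE k hk
    have hsplit := S1.ncard_fourCircuits_le_through_add_delete M e
    rcases Nat.lt_or_ge k 4 with hk4 | hk4
    · -- `k = 3`: at most one quad through `e`; `m = n − 4 ≥ 11` non-coloops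
      have hk3' : k = 3 := by omega
      have hthr := ncard_fourCircuitsThrough_le_one_of_three M hcol e (by rw [hk, hk3'])
      have h := havg (n - 4) (by omega) (by omega)
      have hN := S1.le_mul_div_of_sub_div_le (m := n - 4) (by omega) h
      have hN45 : (n - 4) * 28 / (n - 4 - 4) ≤ 45 := by
        rw [Nat.div_le_iff_le_mul_add_pred (by omega)]
        omega
      omega
    · -- `k ≥ 4`: no quad through `e`; `m = 10`
      have hthr := ncard_fourCircuitsThrough_eq_zero_of_four_le M hcol e (by rw [hk]; exact hk4)
      have h := havg 10 (by norm_num) h10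
      have hN := S1.le_mul_div_of_sub_div_le (m := 10) (by norm_num) h
      norm_num at hN
      omega
  · -- CASE B: every point has `≤ 2` series partners — the averaged `x` with `m = n − 3`
    right
    push Not at hA
    rcases Nat.eq_zero_or_pos {C : Set α | M.IsCircuit C ∧ C.ncard = 4}.ncard with h0 | hpos
    · rw [h0]; simp
    obtain ⟨x, hxE, -, hx⟩ := S1.exists_nonColoop_ncard_fourCircuitsThrough_le M hpos
    have hmn : (M.ground_finite.toFinset.filter (fun x => ¬ M.IsColoop x)).card = n := by
      rw [Finset.filter_true_of_mem, ← Set.ncard_eq_toFinset_card _ M.ground_finite, hn]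
      intro y _
      rw [Matroid.isColoop_iff_mem_coloops, hcol]
      exact Set.notMem_empty y
    rw [hmn] at hx
    obtain ⟨k, hk⟩ : ∃ k, (M ＼ {x}).coloops.ncard = k := ⟨_, rfl⟩
    have hk2 : k ≤ 2 := by have := hA x hxE; omega
    obtain ⟨-, havg⟩ := hdel x hxE k hk
    have h := havg (n - 3) (by omega) (by omega)
    have hN := S1.le_mul_div_of_sub_div_le (m := n - 3) (by omega) h
    have hsplit := S1.ncard_fourCircuits_le_through_add_delete M x
    have e1 : n - 3 - 4 = n - 7 := by omega
    rw [e1] at hN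
    omega

/-- The instances `n = 24` (S2SeriesCapSeven's `46`), `n = 23` (`46`), `n = 18` (`48`): `omega` on the disjunction. -/
theorem ncard_fourCircuits_le_of_seven_free_of_card_examples (s : ℕ) :
    (s ≤ 46 ∨ s - 4 * s / 24 ≤ (24 - 3) * 28 / (24 - 7) → s ≤ 46) ∧
    (s ≤ 46 ∨ s - 4 * s / 23 ≤ (23 - 3) * 28 / (23 - 7) → s ≤ 46) ∧
    (s ≤ 46 ∨ s - 4 * s / 18 ≤ (18 - 3) * 28 / (18 - 7) → s ≤ 48) := by
  refine ⟨fun h => ?_, fun h => ?_, fun h => ?_⟩ <;> norm_num at h <;> omega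

end S2

end PercRepro
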